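import Literature.Geometry.Symplectic.TaubesCanonicalSolution
import Literature.Geometry.GaugeTheory.SeibergWittenAPrioriBound
import HarnessLib

/-!
# The Weitzenböck identity for Taubes's `r`-family: `½d*d|ψ|² + |∇_Aψ|² + … ` pointwise

Topic `Literature/Geometry/Symplectic`; continues `TaubesCanonicalSolution` (in the unitary frames of
the canonical `Spin^c` structure `𝔰_J` of `(N, s, J)`, `iρ⁺(t·s) = 2t·diag(-1, 1)`: the trivial
summand `I ∋ u₀ = (0, 1)`) with `GaugeTheory/SeibergWittenAPrioriBound` (the pointwise Bochner/
Weitzenböck consequence for `(SW_η)`: `Re⟨∇_A^*∇_Aψ, ψ⟩ = -(κ/4)|ψ|² - |ψ|⁴/4 - Re⟨½iρ⁺(η)ψ, ψ⟩`,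
Morgan Cor. 5.2.2, and its sign at a local maximum of `|ψ|²`).

Taubes 1994, §2, proof of Lemma 3: "compute the Weitzenböck formula for `D_A D_A ψ` …
(8) `D_A²ψ = ∇_A*∇_Aψ + s·ψ + 2⁻¹(P₊F_A)·ψ` … take the inner product of the resulting equation with
`ψ` to find that (9) `2⁻¹·d*d|ψ|² + |∇_Aψ|² + s|ψ|² + ⟨ψ, 2⁻¹(P₊F_A)ψ⟩ = 0`.  Now one should
substitute for `P₊F_A` from (6) into the last term above" — giving (12)
`2⁻¹d*d|ψ|² + |∇_Aψ|² + |ψ|⁴ = R(ψ, ∇_Aψ)`.  For the family `η = η₀ - (|c|²/4)·s` of the tree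
(Taubes 1995, (5.2), `r = |c|²`) the substitution is explicit: Clifford multiplication by the
symplectic perturbation is diagonal in `S⁺ = K⁻¹ ⊕ I`,
`Re⟨½iρ⁺(-(|c|²/4)s)ψ, ψ⟩ = -(|c|²/4)(|ψ₁|² - |ψ₀|²)` (`re_star_dotProduct_half_I_plusAction_symplectic`),
so that

* **`re_star_dotProduct_localLaplacian_taubes`**:
  `Re⟨∇_A^*∇_Aψ, ψ⟩ = -(κ/4)|ψ|² - |ψ|⁴/4 + (|c|²/4)(|ψ₁|² - |ψ₀|²) - Re⟨½iρ⁺(η₀)ψ, ψ⟩`;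
  in Taubes's scaling `ψ = √r(α u₀ + β)` the `r`-terms read
  `-(r²/4)[(|α|² + |β|²)² - |α|² + |β|²] = -(r²/4)[(|α|² + |β|²)(|α|² + |β|² - 1) + 2|β|²]`;
* **`normSq_sq_sub_le_of_isLocalMax_taubes`** (the sign at a local maximum of `|ψ|²`, as in the
  maximum principle behind the `L^∞` bound):
  `|ψ|⁴/4 - (|c|²/4)(|ψ₁|² - |ψ₀|²) ≤ -(κ/4)|ψ|² - Re⟨½iρ⁺(η₀)ψ, ψ⟩`.

PROVED, 0 named facts.

## References

* C. H. Taubes, *The Seiberg–Witten invariants and symplectic forms*, Math. Res. Lett. 1 (1994)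
  809–822, §2 (8), (9), (12). [Taubes1994]
* C. H. Taubes, *The Seiberg–Witten and Gromov invariants*, Math. Res. Lett. 2 (1995) 221–238,
  §5 (5.2)–(5.3). [Taubes1995]
* J. W. Morgan, *The Seiberg–Witten Equations and Applications to the Topology of Smooth
  Four-Manifolds*, Princeton Math. Notes 44 (1996), Cor. 5.1.7, Cor. 5.2.2. [MorganSWBook1996]
-/

noncomputable section

open scoped Manifold ContDiff ComplexConjugate Matrix
open Set Complex Literature.Geometry.Kaehler Literature.Geometry.GaugeTheory Literature.Topology.FourManifolds
open Literature.Geometry.Lorentzian (PseudoRiemannianMetric)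

namespace Literature.Geometry.Symplectic

namespace AlmostComplexStructure.IsCompatibleWith

variable {N : Type*} [TopologicalSpace N] [ChartedSpace (EuclideanSpace ℝ (Fin 4)) N]
  [IsManifold (𝓡 4) ∞ N] {J : AlmostComplexStructure (𝓡 4) ∞ N} {s : MForm (𝓡 4) N ℝ 2}
  (h : J.IsCompatibleWith s) (hs : IsSmoothForm s)
  (hnd : ∀ x (v : TangentSpace (𝓡 4) x), v ≠ 0 → ∃ w : TangentSpace (𝓡 4) x, s x ![v, w] ≠ 0)

/-- **`Re⟨½iρ⁺(t·s)ψ, ψ⟩ = t(|ψ₁|² - |ψ₀|²)`** in every unitary frame of the canonical `Spin^c`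
structure (`iρ⁺(t·s) = 2t·diag(-1, 1)`): Clifford multiplication by the symplectic perturbation is
diagonal in `S⁺ = K⁻¹ ⊕ I`. [cite: Taubes1994, §2 (after (9), p. 813)] -/
theorem re_star_dotProduct_half_I_plusAction_symplectic (t : ℝ) (x₀ : N) {x : N}
    (hx : x ∈ (h.canonicalSpincStructure hs hnd).baseSet x₀) (ψ : Fin 2 → ℂ) :
    (star ψ ⬝ᵥ (((2 : ℂ)⁻¹ * I) •
        (plusAction (twoFormMatrix (t • s) x fun k ↦ (h.canonicalSpincStructure hs hnd).frame x₀ k x) *ᵥ ψ))).re =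
      t * (Complex.normSq (ψ 1) - Complex.normSq (ψ 0)) := by
  rw [mul_smul, ← Matrix.smul_mulVec, h.I_smul_plusAction_twoFormMatrix_smul hs hnd t x₀ hx]
  simp only [Matrix.mulVec, dotProduct, Fin.sum_univ_two, Pi.star_apply, Pi.smul_apply, Matrix.smul_apply,
    Matrix.of_apply, Matrix.cons_val', Matrix.cons_val_zero, Matrix.cons_val_one, Matrix.cons_val_fin_one,
    smul_eq_mul, Complex.star_def]
  have h0 : conj (ψ 0) * ψ 0 = (Complex.normSq (ψ 0) : ℂ) := (Complex.normSq_eq_conj_mul_self).symm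
  have h1 : conj (ψ 1) * ψ 1 = (Complex.normSq (ψ 1) : ℂ) := (Complex.normSq_eq_conj_mul_self).symm
  have key : conj (ψ 0) * (2⁻¹ * (((2 * t : ℝ) : ℂ) * -1 * ψ 0 + ((2 * t : ℝ) : ℂ) * 0 * ψ 1)) +
      conj (ψ 1) * (2⁻¹ * (((2 * t : ℝ) : ℂ) * 0 * ψ 0 + ((2 * t : ℝ) : ℂ) * 1 * ψ 1)) =
      ((t * (Complex.normSq (ψ 1) - Complex.normSq (ψ 0)) : ℝ) : ℂ) := by
    push_cast
    rw [← h0, ← h1]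
    ring
  rw [key, Complex.ofReal_re]

variable [(h.metric hs).HasLeviCivita]

/-- **Taubes 1994, (9) with (6) substituted, for the family `η = η₀ - (|c|²/4)·s`**: for a solution
`(A, ψ)` of `(SW_η)` and `x` in the chart `x₀` of the canonical `Spin^c` structure,
`Re⟨∇_A^*∇_Aψ, ψ⟩(x) = -(κ/4)|ψ|² - |ψ|⁴/4 + (|c|²/4)(|ψ₁|² - |ψ₀|²) - Re⟨½iρ⁺(η₀)ψ, ψ⟩` with
`ψ⁺ = (ψ₀, ψ₁)`, `ψ₁` along `u₀` (Taubes's `√r α`), `ψ₀` along `K⁻¹` (`√r β`); with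
`½d*d|ψ|² = Re⟨∇_A^*∇_Aψ, ψ⟩ - |∇_Aψ|²` this is (12) for the family: the `r`-terms are
`-(r²/4)[(|α|² + |β|²)(|α|² + |β|² - 1) + 2|β|²]`. [cite: Taubes1994, §2 (9), (12)] -/
theorem re_star_dotProduct_localLaplacian_taubes (η₀ : (h.canonicalSpincStructure hs hnd).Perturbation) (c : ℂ)
    {cfg : (h.canonicalSpincStructure hs hnd).Configuration}
    (hsol : SpincStructure.IsSolution (η₀ - h.symplecticPerturbation hs hnd (Complex.normSq c / 4)) cfg)
    (x₀ : N) {x : N} (hx : x ∈ (h.canonicalSpincStructure hs hnd).baseSet x₀) :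
    (star (cfg.spinor.toFun x₀ x) ⬝ᵥ
        (h.canonicalSpincStructure hs hnd).localLaplacian cfg.conn x₀ (cfg.spinor.toFun x₀) x).re =
      -((h.canonicalSpincStructure hs hnd).frameScalarCurv x₀ x / 4) * spinorNormSq (cfg.plusSpinor x₀ x)
        - spinorNormSq (cfg.plusSpinor x₀ x) ^ 2 / 4
        + Complex.normSq c / 4 * (Complex.normSq (cfg.plusSpinor x₀ x 1) - Complex.normSq (cfg.plusSpinor x₀ x 0))
        - (star (cfg.plusSpinor x₀ x) ⬝ᵥ (((2 : ℂ)⁻¹ * I) •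
            (plusAction (twoFormMatrix η₀.form x fun k ↦ (h.canonicalSpincStructure hs hnd).frame x₀ k x) *ᵥ
              cfg.plusSpinor x₀ x))).re := by
  rw [(h.canonicalSpincStructure hs hnd).re_star_dotProduct_localLaplacian_of_isSolution hsol hx,
    SpincStructure.Perturbation.plusAction_twoFormMatrix_sub, Matrix.sub_mulVec, smul_sub, dotProduct_sub,
    Complex.sub_re, symplecticPerturbation_form, h.re_star_dotProduct_half_I_plusAction_symplectic hs hnd _ x₀ hx]
  ring

/-- **The sign at a local maximum of `|ψ|²`** (the maximum-principle step of the `L^∞` bound for the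
family): if `|ψ_{x₀}|²` has a local maximum at `x ∈ U_{x₀}`, then
`|ψ|⁴/4 - (|c|²/4)(|ψ₁|² - |ψ₀|²) ≤ -(κ/4)|ψ|² - Re⟨½iρ⁺(η₀)ψ, ψ⟩` at `x`
(`Re⟨∇_A^*∇_Aψ, ψ⟩ ≥ 0` there, Morgan Cor. 5.2.2). [cite: Taubes1994, §2 proof of Lemma 3 (p. 814)] -/
theorem normSq_sq_sub_le_of_isLocalMax_taubes (η₀ : (h.canonicalSpincStructure hs hnd).Perturbation) (c : ℂ)
    {cfg : (h.canonicalSpincStructure hs hnd).Configuration}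
    (hsol : SpincStructure.IsSolution (η₀ - h.symplecticPerturbation hs hnd (Complex.normSq c / 4)) cfg)
    (x₀ : N) {x : N} (hx : x ∈ (h.canonicalSpincStructure hs hnd).baseSet x₀)
    (hmax : IsLocalMax (spinorNormSqFun (cfg.spinor.toFun x₀)) x) :
    spinorNormSq (cfg.plusSpinor x₀ x) ^ 2 / 4
        - Complex.normSq c / 4 * (Complex.normSq (cfg.plusSpinor x₀ x 1) - Complex.normSq (cfg.plusSpinor x₀ x 0)) ≤
      -((h.canonicalSpincStructure hs hnd).frameScalarCurv x₀ x / 4) * spinorNormSq (cfg.plusSpinor x₀ x)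
        - (star (cfg.plusSpinor x₀ x) ⬝ᵥ (((2 : ℂ)⁻¹ * I) •
            (plusAction (twoFormMatrix η₀.form x fun k ↦ (h.canonicalSpincStructure hs hnd).frame x₀ k x) *ᵥ
              cfg.plusSpinor x₀ x))).re := by
  have h1 := (h.canonicalSpincStructure hs hnd).scalarCurv_mul_normSq_add_le_of_isLocalMax hsol hx hmax
  rw [SpincStructure.Perturbation.plusAction_twoFormMatrix_sub, Matrix.sub_mulVec, smul_sub, dotProduct_sub,
    Complex.sub_re, symplecticPerturbation_form, h.re_star_dotProduct_half_I_plusAction_symplectic hs hnd _ x₀ hx] at h1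
  linarith

end AlmostComplexStructure.IsCompatibleWith

end Literature.Geometry.Symplectic

end
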